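import Summits.MatrixMultiplication.MatrixMultiplication.Theses.IntegralSignedBoxes

/-!
# Route `IntegralSignedBoxes` — the local–global split of the deciding crux `IntegralExponentTwo`

Item `stmt-MatrixMultiplication-5440` (`IntegralExponentTwo`, "ω(ℤ) = 2": for every `ε > 0` some
`⟨n,n,n⟩`, `n ≥ 2`, is a sum of at most `n^{2+ε}` triads with INTEGER vectors) is the deciding crux of
route `route-MatrixMultiplication-IntegralSignedBoxes`; it is at least as strong as the summit
statement `ω(ℂ) = 2`.  This file PROVES the assembly of its typed decomposition into two pieces,
each strictly weaker than `IntegralExponentTwo` and neither known to imply `ω(ℂ) = 2`: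

* `ModularExponentTwo` — **residue fields**: for every prime `p`, `ω(𝔽_p) = 2` in rank form
  (`∀ ε > 0 ∃ n ≥ 2, R_{𝔽_p}(⟨n,n,n⟩) ≤ n^{2+ε}`, `𝔽_p = ZMod p`);
* `PadicLifting` — **p-adic lifting at the exponent level**, `ω(ℤ_(p)) ≤ ω(𝔽_p)` for every prime
  `p`: if `ω(𝔽_p) ≤ τ` (rank form) then for every `ε > 0` there are `n ≥ 2` and a denominator `D`
  PRIME TO `p` with `R_ℤ(D · ⟨n,n,n⟩) ≤ n^{τ+ε}` (a scheme over `ℤ[1/D] ⊆ ℤ_(p)`; the smeared tensor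
  `D • ⟨n,n,n⟩` over `ℤ` encodes the denominators).

`IntegralExponentTwo_of_subs : ModularExponentTwo → PadicLifting → IntegralExponentTwo` (the
hypotheses are written out verbatim, so that the theorem elaborates before the route's split
installs the two decls).  The proof is the LOCAL–GLOBAL PRINCIPLE for the integral exponent
(Pan 1984, §5: `ω_ℚ ≤ ω_F ≤ ω_ℤ`, open problems (i) `ω_ℚ = ω_ℤ`, (ii) `ω_ℤ = ω_{ℤ/p}`):

1. at every prime `p` the two pieces give `n_p ≥ 2` and `D_p` with `p ∤ D_p` and
   `R_ℤ(D_p · ⟨n_p⟩) ≤ n_p^{2+δ}` (`δ = ε/4`);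
2. INTERPOLATION (`exists_pow_smul_rank_le`): Kronecker powers of the smeared tensor
   (`(D·⟨n⟩)^{⊗S} = D^S · ⟨n^S⟩`, `tensorRank_smul_matMulTensor_pow_le`) and zero-padding
   (`tensorRank_smul_matMulTensor_mono`) give, for EVERY size `m ≥ 1`, some `j` with
   `R_ℤ(D_p^j · ⟨m⟩) ≤ n_p^{2+δ} · m^{2+δ}`;
3. BEZOUT GLUING (`tensorRank_le_glue_primeFactors`): start from the prime `2`; the bad primes are
   the prime factors `q` of `D_2`; peel them off one at a time — with `D = q^e · D'`, `q ∤ D'`, and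
   the local datum `E = D_q^{j'}`, `q ∤ E`, the integers `q^{ej}` and `E` are coprime, so
   `R(D'^j · t) ≤ R(q^{ej} D'^j · t) + R(E · D'^j · t) ≤ R(D^j · t) + R(E · t)`
   (`tensorRank_le_of_isCoprime`: `1 = x a + y b ⇒ t = x(a t) + y(b t)`); induction on the finite set
   of bad primes gives `R_ℤ(⟨m⟩) ≤ (n_2^{2+δ} + ∑_q n_q^{2+δ}) · m^{2+δ}` for all `m`;
4. absorb the constant: `m^{3ε/4} ≥ C` for `m` large, so `R_ℤ(⟨m,m,m⟩) ≤ m^{2+ε}`.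

All rank lemmas are over `ℤ` on finite index types and use only the tree's `tensorRank` toolkit
(`exists_triad_decomposition_tensorRank`, `tensorRank_precomp_le`, `tensorRank_reindex`,
`Blaser2013_lemma58`, `kroneckerTensor_matMulTensor`, `matMulTensor_eq_precomp_castLE`).

References: V. Pan, *How to Multiply Matrices Faster*, LNCS 179 (1984), §5 (ω over a commutative
ring of constants; Thm 5.5, Cor 5.6, problems (i), (ii)) [Pan1984]; P. Bürgisser, M. Clausen,
M. A. Shokrollahi, *Algebraic Complexity Theory* (1997), §15.3, (15.16) [BurgisserClausenShokrollahi1997];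
M. Bläser, *Fast Matrix Multiplication* (2013), Lemma 5.4, 5.8, Thm 5.9 [Blaser2013].
-/

-- single-conjunct summit: the mandated namespace repeats `MatrixMultiplication`.
set_option linter.dupNamespace false

noncomputable section

open scoped BigOperators

namespace Summit.MatrixMultiplication.MatrixMultiplication.Theorems

open Literature.Computability.AlgebraicComplexity
open Summit.MatrixMultiplication.MatrixMultiplication.Theses.IntegralSignedBoxes

/-! ## Rank toolkit over `ℤ` (scaling, sums, Bezout gluing) -/

section Toolkit

variable {ι κ μ : Type*} [Fintype ι] [Fintype κ] [Fintype μ]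

/-- Scaling does not increase the rank: `R(c · t) ≤ R(t)` (scale the first vector of each triad). -/
theorem tensorRank_zsmul_le (c : ℤ) (t : ι → κ → μ → ℤ) : tensorRank (c • t) ≤ tensorRank t := by
  obtain ⟨w, u, v, h⟩ := exists_triad_decomposition_tensorRank t
  refine tensorRank_le_of_eq_sum (fun i a => c * w i a) u v ?_
  funext x y z
  rw [Pi.smul_apply, Pi.smul_apply, Pi.smul_apply, smul_eq_mul, sum_triad_apply]
  conv_lhs => rw [h]
  rw [sum_triad_apply, Finset.mul_sum]
  exact Finset.sum_congr rfl fun i _ => by ring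

/-- Subadditivity: `R(s + t) ≤ R(s) + R(t)` (concatenate two decompositions). -/
theorem tensorRank_add_le' (s t : ι → κ → μ → ℤ) :
    tensorRank (s + t) ≤ tensorRank s + tensorRank t := by
  obtain ⟨w, u, v, hs⟩ := exists_triad_decomposition_tensorRank s
  obtain ⟨w', u', v', ht⟩ := exists_triad_decomposition_tensorRank t
  have hcard : Fintype.card (Fin (tensorRank s) ⊕ Fin (tensorRank t)) =
      tensorRank s + tensorRank t := by simp
  rw [← hcard]
  refine tensorRank_le_card_of_eq_sum (Sum.elim w w') (Sum.elim u u') (Sum.elim v v') ?_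
  rw [Fintype.sum_sum_type]
  simp only [Sum.elim_inl, Sum.elim_inr]
  rw [← hs, ← ht]

/-- **Bezout gluing**: for coprime integers `a, b`, `R(t) ≤ R(a · t) + R(b · t)` — write
`1 = x a + y b`, so `t = x (a t) + y (b t)`. -/
theorem tensorRank_le_of_isCoprime {a b : ℤ} (hab : IsCoprime a b) (t : ι → κ → μ → ℤ) :
    tensorRank t ≤ tensorRank (a • t) + tensorRank (b • t) := by
  obtain ⟨x, y, hxy⟩ := hab
  have ht : t = x • (a • t) + y • (b • t) := by
    funext i j k
    simp only [Pi.add_apply, Pi.smul_apply, smul_eq_mul]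
    linear_combination (-(t i j k)) * hxy
  calc tensorRank t = tensorRank (x • (a • t) + y • (b • t)) := by rw [← ht]
    _ ≤ tensorRank (x • (a • t)) + tensorRank (y • (b • t)) := tensorRank_add_le' _ _
    _ ≤ tensorRank (a • t) + tensorRank (b • t) :=
        Nat.add_le_add (tensorRank_zsmul_le _ _) (tensorRank_zsmul_le _ _)

/-- **Gluing over the bad primes** (induction on a finite set of primes `s` containing the prime
factors of the denominator `D`): if `R(D^j · t) ≤ b` and every `q ∈ s` has a local datum
`E` with `q ∤ E` and `R(E^{j'} · t) ≤ c q`, then `R(t) ≤ b + ∑_{q ∈ s} c q`. -/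
theorem tensorRank_le_glue_primeFactors (t : ι → κ → μ → ℤ) (c : ℕ → ℝ) :
    ∀ (s : Finset ℕ) (D j : ℕ) (b : ℝ), D ≠ 0 → D.primeFactors ⊆ s →
      (∀ q ∈ s, q.Prime ∧ ∃ E : ℕ, ¬ q ∣ E ∧ ∃ j' : ℕ,
        (tensorRank (((E : ℤ) ^ j') • t) : ℝ) ≤ c q) →
      (tensorRank (((D : ℤ) ^ j) • t) : ℝ) ≤ b →
      (tensorRank t : ℝ) ≤ b + ∑ q ∈ s, c q := by
  intro s
  induction s using Finset.induction_on with
  | empty =>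
    intro D j b hD hsub _ hb
    have hD1 : D = 1 := by
      have h0 : D.primeFactors = ∅ := Finset.subset_empty.mp hsub
      rcases Nat.primeFactors_eq_empty.mp h0 with h | h
      · exact absurd h hD
      · exact h
    subst hD1
    have h1 : ((((1 : ℕ) : ℤ)) ^ j) • t = t := by
      funext i k l
      simp
    rw [h1] at hb
    simpa using hb
  | @insert q s hq ih =>
    intro D j b hD hsub hyp hb
    obtain ⟨hqp, E, hE, j', hEj⟩ := hyp q (Finset.mem_insert_self q s)
    set e : ℕ := D.factorization q with he
    set D' : ℕ := D / q ^ e with hD'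
    have hDD' : q ^ e * D' = D := Nat.ordProj_mul_ordCompl_eq_self D q
    have hqD' : ¬ q ∣ D' := Nat.not_dvd_ordCompl hqp hD
    have hD'0 : D' ≠ 0 := (Nat.ordCompl_pos q hD).ne'
    have hsub' : D'.primeFactors ⊆ s := by
      intro r hr
      have hr' := Nat.mem_primeFactors.mp hr
      have hrD : r ∈ D.primeFactors :=
        Nat.mem_primeFactors.mpr ⟨hr'.1, hr'.2.1.trans (Nat.ordCompl_dvd D q), hD⟩
      have hne : r ≠ q := fun h => hqD' (h ▸ hr'.2.1)
      exact Finset.mem_of_mem_insert_of_ne (hsub hrD) hne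
    have hcop : IsCoprime (((q : ℤ) ^ e) ^ j) ((E : ℤ) ^ j') := by
      have h1 : IsCoprime (q : ℤ) (E : ℤ) :=
        Nat.isCoprime_iff_coprime.mpr ((Nat.Prime.coprime_iff_not_dvd hqp).mpr hE)
      exact IsCoprime.pow (IsCoprime.pow_left h1)
    have hcast : ((D : ℤ)) = (q : ℤ) ^ e * (D' : ℤ) := by exact_mod_cast hDD'.symm
    have h1 : ((q : ℤ) ^ e) ^ j • (((D' : ℤ) ^ j) • t) = ((D : ℤ) ^ j) • t := by
      funext i k l
      simp only [Pi.smul_apply, smul_eq_mul]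
      rw [hcast]
      ring
    have h2 : (E : ℤ) ^ j' • (((D' : ℤ) ^ j) • t) = ((D' : ℤ) ^ j) • (((E : ℤ) ^ j') • t) := by
      funext i k l
      simp only [Pi.smul_apply, smul_eq_mul]
      ring
    have hstep : (tensorRank (((D' : ℤ) ^ j) • t) : ℝ) ≤ b + c q := by
      have hg := tensorRank_le_of_isCoprime hcop (((D' : ℤ) ^ j) • t)
      rw [h1, h2] at hg
      have h3 : tensorRank (((D' : ℤ) ^ j) • (((E : ℤ) ^ j') • t)) ≤
          tensorRank (((E : ℤ) ^ j') • t) := tensorRank_zsmul_le _ _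
      have hg' : (tensorRank (((D' : ℤ) ^ j) • t) : ℝ) ≤
          (tensorRank (((D : ℤ) ^ j) • t) : ℝ) + (tensorRank (((E : ℤ) ^ j') • t) : ℝ) := by
        exact_mod_cast hg.trans (Nat.add_le_add_left h3 _)
      linarith
    have hih := ih D' j (b + c q) hD'0 hsub'
      (fun r hr => hyp r (Finset.mem_insert_of_mem hr)) hstep
    rw [Finset.sum_insert hq]
    linarith

end Toolkit

/-! ## Smeared matrix multiplication tensors `D · ⟨n,n,n⟩` over `ℤ`: Kronecker powers, padding -/

/-- `R((cd) · ⟨kk', mm', nn'⟩) ≤ R(c · ⟨k,m,n⟩) · R(d · ⟨k',m',n'⟩)` — Bläser's Lemma 5.8 with the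
identity `⟨k,m,n⟩ ⊗ ⟨k',m',n'⟩ = ⟨kk',mm',nn'⟩`, scalars riding along. -/
theorem tensorRank_smul_matMulTensor_mul_le (c d : ℤ) (k m n k' m' n' : ℕ) :
    tensorRank ((c * d) • matMulTensor ℤ (k * k') (m * m') (n * n')) ≤
      tensorRank (c • matMulTensor ℤ k m n) * tensorRank (d • matMulTensor ℤ k' m' n') := by
  have h := tensorRank_reindex (doubleIndexEquiv k n k' n') (doubleIndexEquiv k m k' m')
    (doubleIndexEquiv m n m' n') ((c * d) • matMulTensor ℤ (k * k') (m * m') (n * n'))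
  rw [← h]
  have heq : (fun a b x => ((c * d) • matMulTensor ℤ (k * k') (m * m') (n * n'))
      (doubleIndexEquiv k n k' n' a) (doubleIndexEquiv k m k' m' b) (doubleIndexEquiv m n m' n' x)) =
      kroneckerTensor (c • matMulTensor ℤ k m n) (d • matMulTensor ℤ k' m' n') := by
    funext a b x
    rw [kroneckerTensor_apply, Pi.smul_apply, Pi.smul_apply, Pi.smul_apply,
      ← kroneckerTensor_matMulTensor, kroneckerTensor_apply]
    simp only [Pi.smul_apply, smul_eq_mul]
    ring
  rw [heq]
  exact Blaser2013_lemma58 _ _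

/-- Kronecker powers of a smeared tensor: `R(D^i · ⟨N^i⟩) ≤ R(D · ⟨N⟩)^i`. -/
theorem tensorRank_smul_matMulTensor_pow_le (D : ℤ) (N i : ℕ) :
    tensorRank ((D ^ i) • matMulTensor ℤ (N ^ i) (N ^ i) (N ^ i)) ≤
      tensorRank (D • matMulTensor ℤ N N N) ^ i := by
  induction i with
  | zero =>
    have h1 : ((D ^ 0) • matMulTensor ℤ (N ^ 0) (N ^ 0) (N ^ 0)) =
        matMulTensor ℤ (N ^ 0) (N ^ 0) (N ^ 0) := by
      funext a b x
      simp only [Pi.smul_apply, smul_eq_mul, pow_zero, one_mul]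
    rw [h1, pow_zero (tensorRank (D • matMulTensor ℤ N N N))]
    exact (tensorRank_matMulTensor_le ℤ _ _ _).trans (by simp)
  | succ i ih =>
    rw [pow_succ, pow_succ, pow_succ]
    exact (tensorRank_smul_matMulTensor_mul_le (D ^ i) D (N ^ i) (N ^ i) (N ^ i) N N N).trans
      (Nat.mul_le_mul_right _ ih)

/-- Zero-padding a smeared tensor: `n ≤ m → R(D · ⟨n⟩) ≤ R(D · ⟨m⟩)`. -/
theorem tensorRank_smul_matMulTensor_mono (D : ℤ) {n m : ℕ} (h : n ≤ m) :
    tensorRank (D • matMulTensor ℤ n n n) ≤ tensorRank (D • matMulTensor ℤ m m m) := by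
  have heq : D • matMulTensor ℤ n n n = fun a b x => (D • matMulTensor ℤ m m m)
      (Prod.map (Fin.castLE h) (Fin.castLE h) a) (Prod.map (Fin.castLE h) (Fin.castLE h) b)
      (Prod.map (Fin.castLE h) (Fin.castLE h) x) := by
    rw [matMulTensor_eq_precomp_castLE ℤ h]
    rfl
  rw [heq]
  exact tensorRank_precomp_le _ _ _ _

/-- **Interpolation**: one smeared scheme `R(D · ⟨n⟩) ≤ n^τ` (`n ≥ 2`, `τ ≥ 0`) gives schemes at every
size, `R(D^j · ⟨m⟩) ≤ n^τ · m^τ` for some `j` (take `n^{S-1} ≤ m < n^S`, pad to `n^S`, use the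
`S`-th Kronecker power). -/
theorem exists_pow_smul_rank_le {n : ℕ} (hn : 2 ≤ n) (D : ℤ) {τ : ℝ} (hτ : 0 ≤ τ)
    (h : (tensorRank (D • matMulTensor ℤ n n n) : ℝ) ≤ (n : ℝ) ^ τ) (m : ℕ) (hm : 1 ≤ m) :
    ∃ j : ℕ, (tensorRank ((D ^ j) • matMulTensor ℤ m m m) : ℝ) ≤ (n : ℝ) ^ τ * (m : ℝ) ^ τ := by
  have hn1 : 1 < n := hn
  set S : ℕ := Nat.log n m + 1 with hS
  have hlt : m < n ^ S := Nat.lt_pow_succ_log_self hn1 m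
  have hle : n ^ S ≤ n * m := by
    rw [hS, pow_succ, mul_comm]
    exact Nat.mul_le_mul_left n (Nat.pow_log_le_self n (by omega))
  refine ⟨S, ?_⟩
  have hnat : tensorRank ((D ^ S) • matMulTensor ℤ m m m) ≤
      tensorRank (D • matMulTensor ℤ n n n) ^ S :=
    (tensorRank_smul_matMulTensor_mono (D ^ S) hlt.le).trans
      (tensorRank_smul_matMulTensor_pow_le D n S)
  have hn0 : (0 : ℝ) ≤ n := Nat.cast_nonneg _
  have hq0 : (0 : ℝ) ≤ (tensorRank (D • matMulTensor ℤ n n n) : ℝ) := Nat.cast_nonneg _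
  calc (tensorRank ((D ^ S) • matMulTensor ℤ m m m) : ℝ)
        ≤ (tensorRank (D • matMulTensor ℤ n n n) : ℝ) ^ S := by exact_mod_cast hnat
    _ ≤ ((n : ℝ) ^ τ) ^ S := pow_le_pow_left₀ hq0 h S
    _ = (((n ^ S : ℕ)) : ℝ) ^ τ := by
        rw [Nat.cast_pow, ← Real.rpow_natCast, ← Real.rpow_natCast, ← Real.rpow_mul hn0,
          mul_comm, Real.rpow_mul hn0]
    _ ≤ ((n * m : ℕ) : ℝ) ^ τ := Real.rpow_le_rpow (Nat.cast_nonneg _) (by exact_mod_cast hle) hτ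
    _ = (n : ℝ) ^ τ * (m : ℝ) ^ τ := by rw [Nat.cast_mul, Real.mul_rpow hn0 (Nat.cast_nonneg _)]

/-! ## The assembly: residue fields + p-adic lifting ⇒ `ω(ℤ) = 2` -/

/-- **Local–global assembly of the split of `IntegralExponentTwo`**:
`ModularExponentTwo → PadicLifting → IntegralExponentTwo` — if `ω(𝔽_p) = 2` for every prime `p`
(rank form) and p-adic lifting holds at the exponent level (`ω(𝔽_p) ≤ τ ⇒` schemes for `⟨n,n,n⟩`
with denominators prime to `p` and `≤ n^{τ+ε}` terms), then `ω(ℤ) = 2`: Bezout gluing over the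
finitely many bad primes of one 2-integral scheme, after interpolating every local scheme to all
sizes.  The two hypotheses are, verbatim, the route items `ModularExponentTwo` and `PadicLifting`
of `IntegralSignedBoxes` (installed by the split of `IntegralExponentTwo`). -/
theorem IntegralExponentTwo_of_subs
    (h₁ : ∀ p : ℕ, p.Prime → ∀ ε : ℝ, 0 < ε → ∃ n : ℕ, 2 ≤ n ∧
      (Literature.Computability.AlgebraicComplexity.tensorRank
        (Literature.Computability.AlgebraicComplexity.matMulTensor (ZMod p) n n n) : ℝ) ≤
        (n : ℝ) ^ (2 + ε))
    (h₂ : ∀ p : ℕ, p.Prime → ∀ τ : ℝ,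
      (∀ ε : ℝ, 0 < ε → ∃ n : ℕ, 2 ≤ n ∧
        (Literature.Computability.AlgebraicComplexity.tensorRank
          (Literature.Computability.AlgebraicComplexity.matMulTensor (ZMod p) n n n) : ℝ) ≤
          (n : ℝ) ^ (τ + ε)) →
      ∀ ε : ℝ, 0 < ε → ∃ n : ℕ, 2 ≤ n ∧ ∃ D : ℕ, ¬ p ∣ D ∧
        (Literature.Computability.AlgebraicComplexity.tensorRank
          ((D : ℤ) • Literature.Computability.AlgebraicComplexity.matMulTensor ℤ n n n) : ℝ) ≤
          (n : ℝ) ^ (τ + ε)) :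
    IntegralExponentTwo := by
  intro ε hε
  set δ : ℝ := ε / 4 with hδ
  have hδ0 : 0 < δ := by positivity
  have h2δ : (0 : ℝ) ≤ 2 + δ := by positivity
  -- Step 1–2: local data at every prime, interpolated to every size.
  have key : ∀ p : ℕ, p.Prime → ∃ n D : ℕ, 2 ≤ n ∧ ¬ p ∣ D ∧ ∀ m : ℕ, 1 ≤ m →
      ∃ j : ℕ, (tensorRank (((D : ℤ) ^ j) • matMulTensor ℤ m m m) : ℝ) ≤
        (n : ℝ) ^ (2 + δ) * (m : ℝ) ^ (2 + δ) := by
    intro p hp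
    obtain ⟨n, hn, D, hD, hb⟩ := h₂ p hp 2 (h₁ p hp) δ hδ0
    exact ⟨n, D, hn, hD, fun m hm => exists_pow_smul_rank_le hn (D : ℤ) h2δ hb m hm⟩
  choose! nf Df hnf hDf hkey using key
  -- Step 3: the base prime 2, its bad primes, and the glued constant.
  set B : Finset ℕ := (Df 2).primeFactors with hB
  set C : ℕ → ℝ := fun p => (nf p : ℝ) ^ (2 + δ) with hC
  set Ctot : ℝ := C 2 + ∑ q ∈ B, C q with hCtot
  have hCnn : ∀ p, 0 ≤ C p := fun p => Real.rpow_nonneg (Nat.cast_nonneg _) _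
  have hCtot0 : 0 ≤ Ctot := add_nonneg (hCnn 2) (Finset.sum_nonneg fun q _ => hCnn q)
  have hD20 : Df 2 ≠ 0 := fun h => hDf 2 Nat.prime_two (h ▸ dvd_zero 2)
  have glued : ∀ m : ℕ, 1 ≤ m →
      (tensorRank (matMulTensor ℤ m m m) : ℝ) ≤ Ctot * (m : ℝ) ^ (2 + δ) := by
    intro m hm
    obtain ⟨j, hj⟩ := hkey 2 Nat.prime_two m hm
    have hyp : ∀ q ∈ B, q.Prime ∧ ∃ E : ℕ, ¬ q ∣ E ∧ ∃ j' : ℕ,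
        (tensorRank (((E : ℤ) ^ j') • matMulTensor ℤ m m m) : ℝ) ≤ C q * (m : ℝ) ^ (2 + δ) := by
      intro q hq
      have hqp : q.Prime := Nat.prime_of_mem_primeFactors hq
      obtain ⟨j', hj'⟩ := hkey q hqp m hm
      exact ⟨hqp, Df q, hDf q hqp, j', hj'⟩
    have hglue := tensorRank_le_glue_primeFactors (matMulTensor ℤ m m m)
      (fun q => C q * (m : ℝ) ^ (2 + δ)) B (Df 2) j (C 2 * (m : ℝ) ^ (2 + δ)) hD20
      (Finset.Subset.refl _) hyp hj
    calc (tensorRank (matMulTensor ℤ m m m) : ℝ)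
          ≤ C 2 * (m : ℝ) ^ (2 + δ) + ∑ q ∈ B, C q * (m : ℝ) ^ (2 + δ) := hglue
      _ = Ctot * (m : ℝ) ^ (2 + δ) := by rw [hCtot, add_mul, Finset.sum_mul]
  -- Step 4: absorb the constant.
  set γ : ℝ := 3 * ε / 4 with hγ
  have hγ0 : 0 < γ := by positivity
  obtain ⟨m, hm2, hmC⟩ : ∃ m : ℕ, 2 ≤ m ∧ Ctot ≤ (m : ℝ) ^ γ := by
    refine ⟨⌈Ctot ^ γ⁻¹⌉₊ + 2, by omega, ?_⟩
    have h0 : 0 ≤ Ctot ^ γ⁻¹ := Real.rpow_nonneg hCtot0 _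
    have h1 : Ctot ^ γ⁻¹ ≤ ((⌈Ctot ^ γ⁻¹⌉₊ + 2 : ℕ) : ℝ) := by
      push_cast
      linarith [Nat.le_ceil (Ctot ^ γ⁻¹)]
    calc Ctot = (Ctot ^ γ⁻¹) ^ γ := (Real.rpow_inv_rpow hCtot0 hγ0.ne').symm
      _ ≤ ((⌈Ctot ^ γ⁻¹⌉₊ + 2 : ℕ) : ℝ) ^ γ := Real.rpow_le_rpow h0 h1 hγ0.le
  refine ⟨m, hm2, ?_⟩
  have hm0 : (0 : ℝ) < m := by exact_mod_cast (by omega : 0 < m)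
  calc (tensorRank (matMulTensor ℤ m m m) : ℝ)
        ≤ Ctot * (m : ℝ) ^ (2 + δ) := glued m (by omega)
    _ ≤ (m : ℝ) ^ γ * (m : ℝ) ^ (2 + δ) :=
        mul_le_mul_of_nonneg_right hmC (Real.rpow_nonneg hm0.le _)
    _ = (m : ℝ) ^ (2 + ε) := by
        rw [← Real.rpow_add hm0]
        congr 1
        rw [hγ, hδ]
        ring

end Summit.MatrixMultiplication.MatrixMultiplication.Theorems

end
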